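import Mathlib
import HarnessLib
import Summits.HubbardSuperconductivity.HubbardSuperconductivity.Theorems.KLProgrammeKLRegimeCountertermJacksonRemainderCertFrameHistC4
import Summits.HubbardSuperconductivity.HubbardSuperconductivity.Theorems.KLProgrammeKLRegimeCountertermReadingFn
import Summits.HubbardSuperconductivity.HubbardSuperconductivity.Theorems.KLProgrammePerturbedFermiCurveExplicit
import Summits.HubbardSuperconductivity.HubbardSuperconductivity.Theorems.KLProgrammeKLRegimeCountertermJacksonRemainderScaleLaw
import Summits.HubbardSuperconductivity.HubbardSuperconductivity.Theorems.KLProgrammeKLRegimeEngineV8DoorGfr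
import Summits.HubbardSuperconductivity.HubbardSuperconductivity.Theorems.KLProgrammeKLRegimeSplitTwoLegThresholdsExplicit
import Summits.HubbardSuperconductivity.HubbardSuperconductivity.Theorems.KLProgrammeKLRegimeCountertermJacksonRemainderCertFrameRecord2048
import Summits.HubbardSuperconductivity.HubbardSuperconductivity.Theorems.KLProgrammeKLRegimeCountertermJacksonRemainderCertFrameRecord512
import Summits.HubbardSuperconductivity.HubbardSuperconductivity.Theorems.KLProgrammeKLRegimeCountertermJacksonRemainderCertFrameRecord128Refined
import Summits.HubbardSuperconductivity.HubbardSuperconductivity.Theorems.KLProgrammeKLRegimeCountertermJacksonRemainderCertFrameRecord256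

/-!
# Route `KLProgramme`, crux K3 — gen-8 ENGINE-FLOW child (stmt-HubbardSuperconductivity-20437 `KLRegimeEngineV17F2`), stub (C)
# `stub_twoLeg_curvature`: the (C1) door of the residue split IN ONE CALL — the Jackson-remainder jets from the certificate, keyed by the
# stub's regime, `FrameOK` at the new flow frame, the history's frame sizes and a `C⁴` induction hypothesis

Seat hubbard-kl-k3c3-p1 (g8; row «δμ-flow with klAngularMean constant piece»).  k3c3-p3's `…FlowReadResidueSplit` splits the renormalisation
residue (P) of c4a-1's `…C4aReadJetAssembly` EXACTLY as (B) frame response + (C2) transport + (C1) Jackson remainder, and its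
`readResidue_flow_hP` asks, for the (C1) bracket
  `J(θ) = ν_n(K_n)(θ) − (klFlowPiece n).eval (k_F^{K_{n+1}} θ)`,
the pair `hJdiff : ContDiff ℝ 4 J`, `hJ : ∀ k ≤ 4, |∂ᵏJ(θ)| ≤ …`.  This file supplies that pair from the (C1) certificate of record
(`CutoffDefectCertFrame (klFlowDeg n) A T`, tables `klC1TableF128r/512/2048`) with EVERY side hypothesis of the `C⁴`-history consumers
(`…CertFrameHistC4`: `hon`, `hang`, `hflat`, `hcurve`, `hr`) DISCHARGED BY NAME from `FrameOK R U (nScales β) μ K_{n+1}` at the explicit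
thresholds `c ≤ klCurveC3 R`, `U ≤ klCurveU0 R` (`frame_sizes_of_frameOK_explicit` ⇒ `A ≤ 1/20 = klFlatR`; `klFlatCutoffFn_klFermiPoint`,
`apply_polarAngle_centredRep_klFermiPoint`, `klFrameExtFn_apply_klFermiPoint`, `freeBandFn_klFermiPoint_sub`, `contDiff_klFermiRadius`):

* §1 `frameOK_explicit_onCurve` — the five on-curve facts + `C⁴` of `u_K`, `k_F^K` for ANY admissible frame (so for `K_{n+1}`);
* §2 **`readResidueC1_jets_of_certFrame`** — from the regime, `FrameOK … K_{n+1}`, `CutoffDefectCertFrame (klFlowDeg n) A T`, frame sizes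
  `‖Dʲ evalM K_{n+1}‖ ≤ A j`, and the INDUCTION HYPOTHESIS in natural-size form (`ν_n(K_n) ∈ C⁴`, `|∂ˡν_n(K_n)| ≤ a l` for `1 ≤ l ≤ 4`, mean-free
  sup `≤ a 0`): `J ∈ C⁴`, `|J| ≤ a₁·Td + a₀·N0`, `|∂ᵏJ| ≤ T.bound a k` (`1 ≤ k ≤ 3`, rate rows) and `|∂ᵏJ| ≤ T.boundNR a k` (`1 ≤ k ≤ 4`, no-rate
  rows — the `k = 4` row the `C⁴` history can pay); `a₀` defaults: `abs_sub_klAngularMean_le_two_mul_of_abs_le` (`a₀ := 2·sup|ν_n|`) or the tree's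
  `abs_sub_klAngularMean_le_of_deriv` (`a₀ := 2π·a₁`);
* §3 `flowFrame_sizes_le_of_klEngU₀4` — the frame-size hypothesis `hA` at the records' `A ≡ 10⁻¹²` from the HISTORY's flow-piece jets
  (`FlowPieceJetsAt … m`, `m ≤ n`; k3c3-p3's `flowFrame_sizes_closed`) for `n + 1 ≤ 4` and `U ≤ klEngU₀4 P R c` (so under the stub's
  `U ≤ klEngU₀9`): every size `≤ 2¹⁶·Gfr_j·|U| ≤ 2⁻¹¹¹`.

Assembly only; no definitions; the certificate Prop stays a hypothesis; nothing here asserts superconductivity.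
-/

noncomputable section

namespace Summit.HubbardSuperconductivity.HubbardSuperconductivity.Theorems.KLRegimeSplit

set_option linter.dupNamespace false -- summit = problem name (single-conjunct summit), D-0017

open Real MeasureTheory Set
open Literature.MathematicalPhysics.QuantumLattice Literature.Probability.LatticeModels
open Literature.MathematicalPhysics.QuantumLattice.BandSectorCounting
open Summit.HubbardSuperconductivity.HubbardSuperconductivity.Theorems.PerturbedFermiCurve
open Summit.HubbardSuperconductivity.HubbardSuperconductivity.Theorems.EngineV8

/-! ## §1 On-curve geometry of an admissible frame at the explicit thresholds -/

section Geometry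

variable {R : RenConsts} (hR : ∀ j, 0 ≤ R.Gfr j) {c : ℝ} (hc : 0 < c) (hcle : c ≤ klCurveC3 R) {U : ℝ} (hU : 0 < U)
  (hUle : U ≤ klCurveU0 R) {β : ℝ} (hβmin : klBetaMin ≤ β) (hβc : β ≤ Real.exp (c / U ^ 2)) {μ : ℝ} (hμ : μ ∈ klWindowC)
  {K : TrigPolyC4v} (hK : FrameOK R U (nScales β) μ K)
include hR hc hcle hU hUle hβmin hβc hμ hK

/-- **On-curve geometry of an admissible frame** (`0 < c ≤ klCurveC3 R`, `0 < U ≤ klCurveU0 R`, `klBetaMin ≤ β ≤ e^{c/U²}`, `μ ∈ klWindowC`,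
`FrameOK R U (nScales β) μ K`): the flat cutoff is `1` on the curve; a `2π`-periodic profile read at the polar angle of the Fermi point is its
value at `θ`; the G-extension reads its profile on the curve; the Fermi point lies on the frame's curve (`ε(k_F θ) − μ = K(k_F θ)`); the frame
radius `u_K` and the Fermi-point map are `C⁴`. -/
theorem frameOK_explicit_onCurve :
    (∀ θ : ℝ, klFlatCutoffFn μ (klFermiPoint μ K θ) = 1) ∧
    (∀ f : ℝ → ℝ, Function.Periodic f (2 * π) → ∀ θ : ℝ, f (polarAngle (centredRep (klFermiPoint μ K θ))) = f θ) ∧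
    (∀ f : ℝ → ℝ, Function.Periodic f (2 * π) → ∀ θ : ℝ, klFrameExtFn μ f (klFermiPoint μ K θ) = f θ) ∧
    (∀ θ : ℝ, freeBandFn (klFermiPoint μ K θ) - μ = K.eval (klFermiPoint μ K θ)) ∧
    ContDiff ℝ 4 (perturbedFermiRadius (fun p : Fin 2 → ℝ => -K.eval p) μ) ∧
    ContDiff ℝ 4 (klFermiPoint μ K) := by
  have ha : (-4 : ℝ) < -1.1 := by norm_num
  have hab : (-1.1 : ℝ) ≤ -0.1 := by norm_num
  have hb : (-0.1 : ℝ) < 0 := by norm_num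
  obtain ⟨hAf, hA20, hADt, -, ⟨hlo, hhi⟩, -, -⟩ := frame_sizes_of_frameOK_explicit hR hc hcle hU hUle hβmin hβc hμ hK
  set B := bandBounds ha hab hb with hBdef
  have hAR : 2 * R.Gfr 0 * |U| + 2 * R.Gfr 1 * U ^ 2 + R.Gfr 2 * (c / Real.log 4) ≤ klFlatR := by rw [klFlatR]; exact hA20
  exact ⟨fun θ => klFlatCutoffFn_klFermiPoint B hAf hlo hhi hAR θ,
    fun f hper θ => apply_polarAngle_centredRep_klFermiPoint B hAf hlo hhi hper θ,
    fun f hper θ => klFrameExtFn_apply_klFermiPoint B hAf hlo hhi hAR hper θ,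
    fun θ => freeBandFn_klFermiPoint_sub B hAf hlo hhi θ,
    PerturbedFermiCurve.contDiff_klFermiRadius B hAf hADt hlo hhi (m := 4),
    PerturbedFermiCurve.contDiff_klFermiPoint B hAf hADt hlo hhi (m := 4)⟩

end Geometry

/-! ## §2 The (C1) bracket of the residue split: `C⁴` and its jets from the certificate, one call -/

section Supplier

variable {L M : ℕ} [NeZero L] [NeZero M]

/-- Derivatives of the centred profile are those of the profile (`l ≥ 1`). -/
theorem iteratedDeriv_sub_klAngularMean (f : ℝ → ℝ) {l : ℕ} (hl : 1 ≤ l) (x : ℝ) :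
    iteratedDeriv l (fun x => f x - klAngularMean f) x = iteratedDeriv l f x := by
  have e : (fun x => f x - klAngularMean f) = fun x => -klAngularMean f + f x := by funext x; ring
  rw [e, iteratedDeriv_const_add (by omega)]

/-- **Default mean-free sup from a sup**: `|f| ≤ b` everywhere ⇒ `|f(x) − mean f| ≤ 2b`. -/
theorem abs_sub_klAngularMean_le_two_mul_of_abs_le {f : ℝ → ℝ} {b : ℝ} (hb : ∀ x, |f x| ≤ b) (x : ℝ) :
    |f x - klAngularMean f| ≤ 2 * b := by
  have hm : |klAngularMean f| ≤ b := abs_klAngularMean_le' hb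
  calc |f x - klAngularMean f| ≤ |f x| + |klAngularMean f| := abs_sub _ _
    _ ≤ b + b := add_le_add (hb x) hm
    _ = 2 * b := by ring

/-- **THE (C1) DOOR OF THE RESIDUE SPLIT, ONE CALL.**  In the regime `0 < c ≤ klCurveC3 R`, `0 < U ≤ klCurveU0 R`, `klBetaMin ≤ β ≤ e^{c/U²}`,
`μ ∈ klWindowC`, with the NEW flow frame admissible (`FrameOK R U (nScales β) μ K_{n+1}`), the (C1) certificate at the piece's Jackson degree
(`CutoffDefectCertFrame (klFlowDeg n) A T`), frame sizes `‖Dʲ evalM K_{n+1}‖ ≤ A j` (`j ≤ 4`; §3 for the records' `A ≡ 10⁻¹²`), and the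
induction hypothesis in natural-size form — `ν_n(K_n) ∈ C⁴`, `|∂ˡν_n(K_n)| ≤ a l` (`1 ≤ l ≤ 4`), `|ν_n(K_n) − mean| ≤ a 0`, `a ≥ 0` — the bracket
`J(θ) = ν_n(K_n)(θ) − (klFlowPiece n).eval (k_F^{K_{n+1}} θ)` is `C⁴` and, at EVERY `θ`:
`|J(θ)| ≤ a₁·Td + a₀·N0`, `|∂ᵏJ(θ)| ≤ T.bound a k` (`1 ≤ k ≤ 3`), `|∂ᵏJ(θ)| ≤ T.boundNR a k` (`1 ≤ k ≤ 4`). -/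
theorem readResidueC1_jets_of_certFrame {R : RenConsts} (hR : ∀ j, 0 ≤ R.Gfr j) {c : ℝ} (hc : 0 < c) (hcle : c ≤ klCurveC3 R)
    {U : ℝ} (hU : 0 < U) (hUle : U ≤ klCurveU0 R) {β : ℝ} (hβmin : klBetaMin ≤ β) (hβc : β ≤ Real.exp (c / U ^ 2))
    {μ : ℝ} (hμ : μ ∈ klWindowC) {n : ℕ} (hK : FrameOK R U (nScales β) μ (klFlowFrameU L M β U μ (n + 1)))
    {d : ℕ} (hd : klFlowDeg n = d) {A : ℕ → ℝ} {T : CutoffDefectTable} (hcert : CutoffDefectCertFrame d A T)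
    (hA : ∀ j ≤ 4, ∀ p : EuclideanSpace ℝ (Fin 2),
      ‖iteratedFDeriv ℝ j (fun q : EuclideanSpace ℝ (Fin 2) => (klFlowFrameU L M β U μ (n + 1)).eval (WithLp.ofLp q)) p‖ ≤ A j)
    (hf : ContDiff ℝ 4 fun θ : ℝ => klLocalPart L M β U μ (klFlowFrameU L M β U μ n) n θ)
    {a : ℕ → ℝ} (ha_nn : ∀ l, 0 ≤ a l)
    (ha0 : ∀ x, |klLocalPart L M β U μ (klFlowFrameU L M β U μ n) n x -
      klAngularMean (fun θ => klLocalPart L M β U μ (klFlowFrameU L M β U μ n) n θ)| ≤ a 0)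
    (ha : ∀ l, 1 ≤ l → l ≤ 4 → ∀ x, |iteratedDeriv l (fun x => klLocalPart L M β U μ (klFlowFrameU L M β U μ n) n x) x| ≤ a l) :
    ContDiff ℝ 4 (fun θ : ℝ => klLocalPart L M β U μ (klFlowFrameU L M β U μ n) n θ -
        (klFlowPiece L M β U μ n).eval (klFermiPoint μ (klFlowFrameU L M β U μ (n + 1)) θ)) ∧
    (∀ θ : ℝ, |klLocalPart L M β U μ (klFlowFrameU L M β U μ n) n θ -
        (klFlowPiece L M β U μ n).eval (klFermiPoint μ (klFlowFrameU L M β U μ (n + 1)) θ)| ≤ a 1 * T.Td + a 0 * T.N0) ∧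
    (∀ k, 1 ≤ k → k ≤ 3 → ∀ θ : ℝ, |iteratedDeriv k (fun θ : ℝ => klLocalPart L M β U μ (klFlowFrameU L M β U μ n) n θ -
        (klFlowPiece L M β U μ n).eval (klFermiPoint μ (klFlowFrameU L M β U μ (n + 1)) θ)) θ| ≤ T.bound a k) ∧
    (∀ k, 1 ≤ k → k ≤ 4 → ∀ θ : ℝ, |iteratedDeriv k (fun θ : ℝ => klLocalPart L M β U μ (klFlowFrameU L M β U μ n) n θ -
        (klFlowPiece L M β U μ n).eval (klFermiPoint μ (klFlowFrameU L M β U μ (n + 1)) θ)) θ| ≤ T.boundNR a k) := by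
  set K' : TrigPolyC4v := klFlowFrameU L M β U μ (n + 1) with hK'def
  set f : ℝ → ℝ := fun θ => klLocalPart L M β U μ (klFlowFrameU L M β U μ n) n θ with hfdef
  have hper : Function.Periodic f (2 * π) := klLocalPart_periodic β U μ _ n
  obtain ⟨hflat, hangAll, honAll, hcurve, hr, hkF⟩ := frameOK_explicit_onCurve hR hc hcle hU hUle hβmin hβc hμ hK
  have hang : ∀ θ, f (polarAngle (centredRep (klFermiPoint μ K' θ))) = f θ := hangAll f hper
  have hon : ∀ θ, klFrameExtFn μ f (klFermiPoint μ K' θ) = f θ := honAll f hper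
  -- sizes of the centred profile
  have ha' : ∀ l, 1 ≤ l → l ≤ 4 → ∀ x, |iteratedDeriv l (fun x => f x - klAngularMean f) x| ≤ a l := fun l hl1 hl4 x => by
    rw [iteratedDeriv_sub_klAngularMean f hl1]; exact ha l hl1 hl4 x
  refine ⟨?_, ?_, ?_, ?_⟩
  · -- `C⁴`: the profile is `C⁴`, the piece is a trigonometric polynomial read along a `C⁴` curve
    exact hf.sub ((TrigPolyC4v.contDiff_eval (klFlowPiece L M β U μ n)).comp hkF)
  · intro θ
    exact flowPiece_reading_remainder_value_of_certFrame (L := L) (M := M) hcert β U hμ n hd K' hA hr hcurve hf hon hang ha_nn ha0 ha'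
      hflat θ
  · intro k hk1 hk θ
    exact flowPiece_reading_remainder_jets_of_certFrame_rate (L := L) (M := M) hcert β U hμ n hd K' hA hr hcurve hf hon hang ha_nn ha0 ha'
      hflat hk1 hk θ
  · intro k hk1 hk θ
    exact flowPiece_reading_remainder_jets_of_certFrame_noRate (L := L) (M := M) hcert β U hμ n hd K' hA hr hcurve hf hon hang ha_nn ha0
      ha' hflat hk1 hk θ

end Supplier

/-! ## §3 The frame-size hypothesis from the history's flow-piece jets -/

section FrameSizes

variable {L M : ℕ} [NeZero L] [NeZero M]

/-- `Gfr_j·U ≤ 2⁻¹²⁷` below the v4 coupling door (`U ≤ klEngU₀4 P R c = 2⁻¹²⁸/(Psq⁴·Rsq⁴·(c²+1))`, `Gfr_j + 1 ≤ 2·Rsq`, `Psq, Rsq ≥ 1`). -/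
theorem gfr_mul_le_of_le_klEngU₀4 {P : SplitConsts} {R : RenConsts} (hRW : R.WF) {c U : ℝ} (hUle : U ≤ klEngU₀4 P R c)
    {j : ℕ} (hj : j < 5) : R.Gfr j * U ≤ 1 / 2 ^ 127 := by
  have hG := hRW.2.2 j
  have hP1 : 1 ≤ klEngPsq P := one_le_klEngPsq P
  have hR1 : 1 ≤ klEngRsq R := one_le_klEngRsq R
  have hGR : R.Gfr j + 1 ≤ 2 * klEngRsq R := gfr_add_one_le_two_mul_klEngRsq R hj
  have hc1 : (1 : ℝ) ≤ c ^ 2 + 1 := by nlinarith [sq_nonneg c]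
  have hP4 : (1 : ℝ) ≤ klEngPsq P ^ 4 := one_le_pow₀ hP1
  have hR4 : klEngRsq R ≤ klEngRsq R ^ 4 := by
    calc klEngRsq R = klEngRsq R ^ 1 := (pow_one _).symm
      _ ≤ klEngRsq R ^ 4 := pow_le_pow_right₀ hR1 (by norm_num)
  -- `U ≤ 1/(2^128·Rsq)`
  have hden : (2 : ℝ) ^ 128 * klEngRsq R ≤ (2 : ℝ) ^ 128 * klEngPsq P ^ 4 * klEngRsq R ^ 4 * (c ^ 2 + 1) := by
    have hr0 : 0 ≤ klEngRsq R := by linarith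
    calc (2 : ℝ) ^ 128 * klEngRsq R = (2 : ℝ) ^ 128 * 1 * klEngRsq R * 1 := by ring
      _ ≤ (2 : ℝ) ^ 128 * klEngPsq P ^ 4 * klEngRsq R ^ 4 * (c ^ 2 + 1) := by
          apply mul_le_mul _ hc1 zero_le_one (by positivity)
          exact mul_le_mul (mul_le_mul_of_nonneg_left hP4 (by positivity)) hR4 hr0 (by positivity)
  have hU' : U ≤ 1 / ((2 : ℝ) ^ 128 * klEngRsq R) := by
    refine hUle.trans ?_
    unfold klEngU₀4
    exact one_div_le_one_div_of_le (by positivity) hden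
  have hRpos : 0 < klEngRsq R := by linarith
  calc R.Gfr j * U ≤ R.Gfr j * (1 / ((2 : ℝ) ^ 128 * klEngRsq R)) := mul_le_mul_of_nonneg_left hU' hG
    _ ≤ (2 * klEngRsq R) * (1 / ((2 : ℝ) ^ 128 * klEngRsq R)) :=
        mul_le_mul_of_nonneg_right (by linarith) (by positivity)
    _ = 1 / 2 ^ 127 := by field_simp

/-- **The records' frame-size hypothesis from the history**: for `n ≤ 4`, `R.WF`, `0 < U ≤ klEngU₀4 P R c` and flow-piece jets at every scale
`m < n` (`FlowPieceJetsAt … m`, the history's slots), every frame size `‖Dʲ evalM K_n‖` (`j ≤ 4`) is `≤ 10⁻¹²` (indeed `≤ 2⁻¹¹¹`). -/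
theorem flowFrame_sizes_le_of_klEngU₀4 {P : SplitConsts} {R : RenConsts} (hRW : R.WF) {c β U μ : ℝ} (hU : 0 < U)
    (hUle : U ≤ klEngU₀4 P R c) {n : ℕ} (hn : n ≤ 4) (hist : ∀ m < n, FlowPieceJetsAt L M β U μ R m) :
    ∀ j ≤ 4, ∀ p : EuclideanSpace ℝ (Fin 2),
      ‖iteratedFDeriv ℝ j (fun q : EuclideanSpace ℝ (Fin 2) => (klFlowFrameU L M β U μ n).eval (WithLp.ofLp q)) p‖ ≤ 1 / 10 ^ 12 := by
  intro j hj p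
  have hR : ∀ j, 0 ≤ R.Gfr j := hRW.2.2
  obtain ⟨h0, h1, h2, h3, h4⟩ := flowFrame_sizes_closed (L := L) (M := M) (β := β) (μ := μ) hR hist p
  have hg : ∀ i < 5, R.Gfr i * U ≤ 1 / 2 ^ 127 := fun i hi => gfr_mul_le_of_le_klEngU₀4 hRW hUle hi
  have hU1 : U ≤ 1 := by
    have h := hUle.trans (klEngU₀4_le_inv_gfr_add_one P hRW c (show 0 < 5 by norm_num))
    have hG0 := hR 0
    calc U ≤ 1 / (R.Gfr 0 + 1) := h
      _ ≤ 1 := by rw [div_le_one (by linarith)]; linarith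
  have hUabs : |U| = U := abs_of_pos hU
  have hU2 : U ^ 2 ≤ U := by nlinarith
  have h4n : (4 : ℝ) ^ n ≤ 256 := by
    calc (4 : ℝ) ^ n ≤ 4 ^ 4 := pow_le_pow_right₀ (by norm_num) hn
      _ = 256 := by norm_num
  have h16n : (16 : ℝ) ^ n ≤ 65536 := by
    calc (16 : ℝ) ^ n ≤ 16 ^ 4 := pow_le_pow_right₀ (by norm_num) hn
      _ = 65536 := by norm_num
  have hn4 : (n : ℝ) ≤ 4 := by exact_mod_cast hn
  have e : (fun q : EuclideanSpace ℝ (Fin 2) => (klFlowFrameU L M β U μ n).eval (WithLp.ofLp q)) = evalM (klFlowFrameU L M β U μ n) := rfl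
  rw [e]
  have hG := hR j
  interval_cases j
  · have hg0 := hg 0 (by norm_num)
    rw [hUabs] at h0
    calc _ ≤ 16 / 15 * R.Gfr 0 * U := h0
      _ = 16 / 15 * (R.Gfr 0 * U) := by ring
      _ ≤ 16 / 15 * (1 / 2 ^ 127) := by gcongr
      _ ≤ 1 / 10 ^ 12 := by norm_num
  · have hg1 := hg 1 (by norm_num)
    calc _ ≤ 4 / 3 * R.Gfr 1 * U ^ 2 := h1
      _ ≤ 4 / 3 * R.Gfr 1 * U := by gcongr
      _ = 4 / 3 * (R.Gfr 1 * U) := by ring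
      _ ≤ 4 / 3 * (1 / 2 ^ 127) := by gcongr
      _ ≤ 1 / 10 ^ 12 := by norm_num
  · have hg2 := hg 2 (by norm_num)
    calc _ ≤ n * R.Gfr 2 * U ^ 2 := h2
      _ ≤ 4 * R.Gfr 2 * U := by
          have : (n : ℝ) * R.Gfr 2 * U ^ 2 ≤ 4 * R.Gfr 2 * U ^ 2 := by gcongr
          exact this.trans (by nlinarith [mul_nonneg (show (0:ℝ) ≤ 4 * R.Gfr 2 by positivity) (sub_nonneg.2 hU2)])
      _ = 4 * (R.Gfr 2 * U) := by ring
      _ ≤ 4 * (1 / 2 ^ 127) := by gcongr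
      _ ≤ 1 / 10 ^ 12 := by norm_num
  · have hg3 := hg 3 (by norm_num)
    calc _ ≤ R.Gfr 3 / 3 * U ^ 2 * 4 ^ n := h3
      _ ≤ R.Gfr 3 / 3 * U * 256 := by gcongr
      _ = 256 / 3 * (R.Gfr 3 * U) := by ring
      _ ≤ 256 / 3 * (1 / 2 ^ 127) := by gcongr
      _ ≤ 1 / 10 ^ 12 := by norm_num
  · have hg4 := hg 4 (by norm_num)
    calc _ ≤ R.Gfr 4 / 15 * U ^ 2 * 16 ^ n := h4
      _ ≤ R.Gfr 4 / 15 * U * 65536 := by gcongr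
      _ = 65536 / 15 * (R.Gfr 4 * U) := by ring
      _ ≤ 65536 / 15 * (1 / 2 ^ 127) := by gcongr
      _ ≤ 1 / 10 ^ 12 := by norm_num

/-- The same below the stub's registered binder `U ≤ klEngU₀9 P R c` (`klEngU₀9 ≤ klEngU₀4`). -/
theorem flowFrame_sizes_le_of_klEngU₀9 {P : SplitConsts} {R : RenConsts} (hRW : R.WF) {c β U μ : ℝ} (hU : 0 < U)
    (hUle : U ≤ klEngU₀9 P R c) {n : ℕ} (hn : n ≤ 4) (hist : ∀ m < n, FlowPieceJetsAt L M β U μ R m) :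
    ∀ j ≤ 4, ∀ p : EuclideanSpace ℝ (Fin 2),
      ‖iteratedFDeriv ℝ j (fun q : EuclideanSpace ℝ (Fin 2) => (klFlowFrameU L M β U μ n).eval (WithLp.ofLp q)) p‖ ≤ 1 / 10 ^ 12 :=
  flowFrame_sizes_le_of_klEngU₀4 hRW hU (hUle.trans (klEngU₀9_le_klEngU₀4 P R c)) hn hist

/-- **`hA` for the records**: any size table `A` with `10⁻¹² ≤ A j` (`j ≤ 4`) — in particular `klC1FrameAF128r/256/512/2048 ≡ 10⁻¹²` — is met by
the flow frame `K_n`, `n ≤ 4`, below `klEngU₀9`. -/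
theorem flowFrame_sizes_le_table_of_klEngU₀9 {P : SplitConsts} {R : RenConsts} (hRW : R.WF) {c β U μ : ℝ} (hU : 0 < U)
    (hUle : U ≤ klEngU₀9 P R c) {n : ℕ} (hn : n ≤ 4) (hist : ∀ m < n, FlowPieceJetsAt L M β U μ R m)
    {A : ℕ → ℝ} (hA12 : ∀ j ≤ 4, (1 : ℝ) / 10 ^ 12 ≤ A j) :
    ∀ j ≤ 4, ∀ p : EuclideanSpace ℝ (Fin 2),
      ‖iteratedFDeriv ℝ j (fun q : EuclideanSpace ℝ (Fin 2) => (klFlowFrameU L M β U μ n).eval (WithLp.ofLp q)) p‖ ≤ A j :=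
  fun j hj p => (flowFrame_sizes_le_of_klEngU₀9 hRW hU hUle hn hist j hj p).trans (hA12 j hj)

/-- The records' size tables are `≡ 10⁻¹²` on `j ≤ 4`. -/
theorem klC1FrameA_records_ge :
    (∀ j ≤ 4, (1 : ℝ) / 10 ^ 12 ≤ klC1FrameAF2048 j) ∧ (∀ j ≤ 4, (1 : ℝ) / 10 ^ 12 ≤ klC1FrameAF512 j) ∧
    (∀ j ≤ 4, (1 : ℝ) / 10 ^ 12 ≤ klC1FrameAF128r j) ∧ (∀ j ≤ 4, (1 : ℝ) / 10 ^ 12 ≤ klC1FrameAF256 j) := by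
  refine ⟨?_, ?_, ?_, ?_⟩ <;> intro j hj <;> interval_cases j <;>
    norm_num [klC1FrameAF2048, klC1FrameAF512, klC1FrameAF128r, klC1FrameAF256]

end FrameSizes

/-! ## §4 At the stub's registered binders (`c ≤ klEngC₃6 P R`, `U ≤ klEngU₀9 P R c`), frame sizes from the history -/

section Stub

variable {L M : ℕ} [NeZero L] [NeZero M]

/-- **THE (C1) DOOR AT STUB (C)'s BINDERS, ONE CALL** (reading scales `n + 1 ≤ 4`).  From `R.WF`, `0 < c ≤ klEngC₃6 P R`, `μ ∈ klWindowC`,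
`0 < U ≤ klEngU₀9 P R c`, `klBetaMin ≤ β ≤ e^{c/U²}`, the new flow frame admissible (`FrameOK R U (nScales β) μ K_{n+1}`), the history's flow-piece
jets (`FlowPieceJetsAt … m`, `m ≤ n`), the (C1) certificate `CutoffDefectCertFrame (klFlowDeg n) A T` at ANY size table `A ≥ 10⁻¹²` (the records'
`klC1FrameAF128r/512/2048`, see `klC1FrameA_records_ge`), and the `C⁴` induction hypothesis in natural-size form: the (C1) bracket `J` of the
residue split is `C⁴` with `|J| ≤ a₁·Td + a₀·N0`, `|∂ᵏJ| ≤ T.bound a k` (`1 ≤ k ≤ 3`), `|∂ᵏJ| ≤ T.boundNR a k` (`1 ≤ k ≤ 4`) at every angle —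
the `hJdiff`/`hJ` inputs of `readResidue_flow_hP` (k3c3-p3) for c4a-1's `twoLegReadJetBound_flow_succ`. -/
theorem readResidueC1_jets_of_certFrame_klEng {P : SplitConsts} {R : RenConsts} (hRW : R.WF) {c : ℝ} (hc : 0 < c) (hc6 : c ≤ klEngC₃6 P R)
    {μ : ℝ} (hμ : μ ∈ klWindowC) {U : ℝ} (hU : 0 < U) (hU9 : U ≤ klEngU₀9 P R c) {β : ℝ} (hβmin : klBetaMin ≤ β)
    (hβc : β ≤ Real.exp (c / U ^ 2)) {n : ℕ} (hn : n + 1 ≤ 4) (hK : FrameOK R U (nScales β) μ (klFlowFrameU L M β U μ (n + 1)))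
    (hist : ∀ m < n + 1, FlowPieceJetsAt L M β U μ R m)
    {d : ℕ} (hd : klFlowDeg n = d) {A : ℕ → ℝ} {T : CutoffDefectTable} (hcert : CutoffDefectCertFrame d A T)
    (hA12 : ∀ j ≤ 4, (1 : ℝ) / 10 ^ 12 ≤ A j)
    (hf : ContDiff ℝ 4 fun θ : ℝ => klLocalPart L M β U μ (klFlowFrameU L M β U μ n) n θ)
    {a : ℕ → ℝ} (ha_nn : ∀ l, 0 ≤ a l)
    (ha0 : ∀ x, |klLocalPart L M β U μ (klFlowFrameU L M β U μ n) n x -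
      klAngularMean (fun θ => klLocalPart L M β U μ (klFlowFrameU L M β U μ n) n θ)| ≤ a 0)
    (ha : ∀ l, 1 ≤ l → l ≤ 4 → ∀ x, |iteratedDeriv l (fun x => klLocalPart L M β U μ (klFlowFrameU L M β U μ n) n x) x| ≤ a l) :
    ContDiff ℝ 4 (fun θ : ℝ => klLocalPart L M β U μ (klFlowFrameU L M β U μ n) n θ -
        (klFlowPiece L M β U μ n).eval (klFermiPoint μ (klFlowFrameU L M β U μ (n + 1)) θ)) ∧
    (∀ θ : ℝ, |klLocalPart L M β U μ (klFlowFrameU L M β U μ n) n θ -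
        (klFlowPiece L M β U μ n).eval (klFermiPoint μ (klFlowFrameU L M β U μ (n + 1)) θ)| ≤ a 1 * T.Td + a 0 * T.N0) ∧
    (∀ k, 1 ≤ k → k ≤ 3 → ∀ θ : ℝ, |iteratedDeriv k (fun θ : ℝ => klLocalPart L M β U μ (klFlowFrameU L M β U μ n) n θ -
        (klFlowPiece L M β U μ n).eval (klFermiPoint μ (klFlowFrameU L M β U μ (n + 1)) θ)) θ| ≤ T.bound a k) ∧
    (∀ k, 1 ≤ k → k ≤ 4 → ∀ θ : ℝ, |iteratedDeriv k (fun θ : ℝ => klLocalPart L M β U μ (klFlowFrameU L M β U μ n) n θ -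
        (klFlowPiece L M β U μ n).eval (klFermiPoint μ (klFlowFrameU L M β U μ (n + 1)) θ)) θ| ≤ T.boundNR a k) := by
  have hR : ∀ j, 0 ≤ R.Gfr j := hRW.2.2
  have hcle : c ≤ klCurveC3 R := hc6.trans ((klEngC₃6_le_klEngC₃3 P R).trans (klEngC₃3_le_klCurveC3 P hR))
  have hUle : U ≤ klCurveU0 R := hU9.trans ((klEngU₀9_le_klEngU₀3 P R c).trans (klEngU₀3_le_klCurveU0 P hR c))
  have hA := flowFrame_sizes_le_table_of_klEngU₀9 (L := L) (M := M) (β := β) (μ := μ) hRW hU hU9 hn hist hA12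
  exact readResidueC1_jets_of_certFrame hR hc hcle hU hUle hβmin hβc hμ hK hd hcert hA hf ha_nn ha0 ha

end Stub

end Summit.HubbardSuperconductivity.HubbardSuperconductivity.Theorems.KLRegimeSplit

end
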